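import Summits.RiemannHypothesis.RiemannHypothesis.Theorems.WeilFormatCEntryIncrement
import Summits.RiemannHypothesis.RiemannHypothesis.Theorems.WeilFormatCEntryArchSeries
import Literature.NumberTheory.LFunctions.WeilArchTailPanels
import Literature.NumberTheory.LFunctions.WeilWindowSuzukiProofs
import HarnessLib

/-!
# Format C, entry theorem (L-C1) — VI: the archimedean block of a trigonometric window

Helper file of the rh-explicit Weil-positivity programme (`--supports stmt-RiemannHypothesis-0098`; seat
rh-explicit-weil-2), RH-free, no definitions, no named facts.  Uses `WeilFormatCEntryIncrement.lean` (the
increment form `D_t` of a trigonometric window as a Hermitian form) and `WeilFormatCEntryArchSeries.lean` (the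
archimedean integrals of the window kernels in closed form).

Main result `setIntegral_weilArchDensity_mul_weilIncrement_sum_smul_chi` (`a > 0`, `ρ(t) = e^{t/2}/(2 sinh t)`,
`χ_n = (2a)^{-1/2}e^{πinx/a}·1_{[-a,a]}`, `ω_n = πn/a`):

  `∫₀^∞ ρ(t) D_t(Σ c_n χ_n) dt = Σ_n Σ_m Re(conj c_n · c_m) A(n,m)`,
  `A(n,n) = ∫_{(0,2a]} ρ(t)(2 − 2(1 − t/2a)cos ω_n t) dt + ∫_{(2a,∞)} 2ρ(t) dt`,
  `A(n,m) = −(−1)^{n+m}/(π(n − m)) · (∫_{(0,2a]} ρ(t) sin ω_m t dt − ∫_{(0,2a]} ρ(t) sin ω_n t dt)`  (`n ≠ m`),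

i.e. the archimedean energy `∫₀^∞ ρ D_t` of the window form (`weilDirichletEnergy`, Bombieri's density) is a
Hermitian form with entries the integrals evaluated in `WeilFormatCEntryArchSeries.lean`
(`= Re ψ(¼ + iω_n/2) − ψ(¼) + Re ψ′(¼ + iω_n/2)/(4a) − (1/a)Σ_k e^{−2al_k}(l_k² − ω_n²)/(l_k² + ω_n²)²` on the
diagonal, the `Im ψ` / `S₀` combination off it — Yoshida (5.15)/(5.16)).  Also: integrability of `ρ K` on `(0, 2a]`
for the window kernels (`|K(t)| ≤ Ct`, `tρ(t) ≤ t + ½`).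

References: H. Yoshida, Adv. Stud. Pure Math. 21 (1992) 281–325, §5 pp. 298–301 [Yoshida1992HermitianForms];
E. Bombieri, Rend. Mat. Acc. Lincei (9) 11 (2000), Thm 2 [Bombieri2000Weil].
-/

set_option linter.dupNamespace false

noncomputable section

open Complex Set MeasureTheory Finset
open scoped Real ComplexConjugate BigOperators Topology

namespace Summit.RiemannHypothesis.RiemannHypothesis.Theorems.WeilFormatC

open Literature.NumberTheory.LFunctions Literature.NumberTheory.LFunctions.Yoshida1992
  Literature.Analysis.SpecialFunctions

/-! ## Integrability of the density against the window kernels -/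

/-- `ρ·K` is integrable on `(0, T]` when `K` is continuous on `[0, T]` and `|K(t)| ≤ Ct` there
(`t ρ(t) ≤ t + ½`). -/
theorem integrableOn_weilArchDensity_mul {T : ℝ} (hT : 0 < T) {K : ℝ → ℝ} {C : ℝ} (hK : ContinuousOn K (Icc 0 T))
    (hKb : ∀ t ∈ Ioc 0 T, |K t| ≤ C * t) :
    IntegrableOn (fun t ↦ weilArchDensity t * K t) (Ioc 0 T) := by
  have hC : 0 ≤ C := by
    have h := hKb T ⟨hT, le_rfl⟩
    nlinarith [abs_nonneg (K T)]
  have hconst : IntegrableOn (fun _ : ℝ ↦ C * (T + 1 / 2)) (Ioc 0 T) :=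
    integrableOn_const (measure_Ioc_lt_top (a := (0 : ℝ)) (b := T)).ne
  refine Integrable.mono' hconst ?_ ?_
  · exact ((continuousOn_weilArchDensity.mono fun t ht ↦ ht.1).mul
      (hK.mono Ioc_subset_Icc_self)).aestronglyMeasurable measurableSet_Ioc
  · filter_upwards [ae_restrict_mem measurableSet_Ioc] with t ht
    have hw := weilArchDensity_pos ht.1
    rw [Real.norm_eq_abs, abs_mul, abs_of_pos hw]
    calc weilArchDensity t * |K t| ≤ weilArchDensity t * (C * t) := mul_le_mul_of_nonneg_left (hKb t ht) hw.le
      _ = C * (t * weilArchDensity t) := by ring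
      _ ≤ C * (t + 1 / 2) := mul_le_mul_of_nonneg_left (mul_weilArchDensity_le ht.1) hC
      _ ≤ C * (T + 1 / 2) := by gcongr; exact ht.2

/-- `ρ(t) sin(ω_m t)` is integrable on `(0, 2a]`. -/
theorem integrableOn_weilArchDensity_mul_sin {a : ℝ} (ha : 0 < a) (m : ℤ) :
    IntegrableOn (fun t ↦ weilArchDensity t * Real.sin (π * m / a * t)) (Ioc 0 (2 * a)) :=
  integrableOn_weilArchDensity_mul (by positivity) (C := |π * m / a|) (by fun_prop)
    (fun t ht ↦ abs_sin_mul_le ht.1.le)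

/-- `ρ(t)(2 − 2(1 − t/2a)cos ω_n t)` is integrable on `(0, 2a]`. -/
theorem integrableOn_weilArchDensity_mul_diag {a : ℝ} (ha : 0 < a) (n : ℤ) :
    IntegrableOn (fun t ↦ weilArchDensity t * (2 - 2 * (1 - t / (2 * a)) * Real.cos (π * n / a * t)))
      (Ioc 0 (2 * a)) :=
  integrableOn_weilArchDensity_mul (by positivity) (C := 2 * |π * n / a| + 1 / a) (by fun_prop)
    (fun t ht ↦ abs_diag_kernel_le ha _ ht.1.le)

/-- `ρ(t) K_t(n,m)` is integrable on `(0, 2a]` for the increment kernel of `WeilFormatCEntryIncrement`. -/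
theorem integrableOn_weilArchDensity_mul_kernel {a : ℝ} (ha : 0 < a) (n m : ℤ) :
    IntegrableOn (fun t ↦ weilArchDensity t *
      (if n = m then 2 - 2 * (1 - t / (2 * a)) * Real.cos (π * n / a * t)
        else -(-1 : ℝ) ^ (n + m) * (Real.sin (π * m / a * t) - Real.sin (π * n / a * t)) / (π * (n - m))))
      (Ioc 0 (2 * a)) := by
  by_cases h : n = m
  · simp only [h, if_true]
    exact integrableOn_weilArchDensity_mul_diag ha m
  · simp only [if_neg h]
    have hi : IntegrableOn (fun t ↦ (-(-1 : ℝ) ^ (n + m) / (π * (n - m))) *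
        (weilArchDensity t * Real.sin (π * m / a * t) - weilArchDensity t * Real.sin (π * n / a * t)))
        (Ioc 0 (2 * a)) :=
      ((integrableOn_weilArchDensity_mul_sin ha m).sub (integrableOn_weilArchDensity_mul_sin ha n)).const_mul _
    exact hi.congr_fun (fun t _ ↦ by ring) measurableSet_Ioc

/-! ## The archimedean block of a trigonometric window -/

/-- **The archimedean energy of a trigonometric window as a Hermitian form** (`a > 0`):
`∫₀^∞ ρ(t) D_t(Σ c_n χ_n) dt = Σ_n Σ_m Re(conj c_n · c_m) A(n,m)` with
`A(n,n) = ∫_{(0,2a]} ρ(t)(2 − 2(1 − t/2a)cos ω_n t) dt + ∫_{(2a,∞)} 2ρ(t) dt` and, for `n ≠ m`,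
`A(n,m) = −(−1)^{n+m}/(π(n−m)) · (∫_{(0,2a]} ρ(t) sin ω_m t dt − ∫_{(0,2a]} ρ(t) sin ω_n t dt)`
(closed forms: `setIntegral_weilArchDensity_mul_diag`, `setIntegral_weilArchDensity_mul_sin`). -/
theorem setIntegral_weilArchDensity_mul_weilIncrement_sum_smul_chi {a : ℝ} (ha : 0 < a) (s : Finset ℤ)
    (c : ℤ → ℂ) :
    ∫ t in Ioi 0, weilArchDensity t * weilIncrement (∑ n ∈ s, c n • chi a n) t =
      ∑ n ∈ s, ∑ m ∈ s, (conj (c n) * c m).re *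
        (if n = m then
          (∫ t in Ioc 0 (2 * a), weilArchDensity t * (2 - 2 * (1 - t / (2 * a)) * Real.cos (π * n / a * t))) +
            ∫ t in Ioi (2 * a), weilArchDensity t * 2
         else -(-1 : ℝ) ^ (n + m) / (π * (n - m)) *
          ((∫ t in Ioc 0 (2 * a), weilArchDensity t * Real.sin (π * m / a * t)) -
            ∫ t in Ioc 0 (2 * a), weilArchDensity t * Real.sin (π * n / a * t))) := by
  have hT : (0 : ℝ) < 2 * a := by positivity
  -- the integrand on the two ranges
  have hIoc : EqOn (fun t ↦ weilArchDensity t * weilIncrement (∑ n ∈ s, c n • chi a n) t)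
      (fun t ↦ ∑ n ∈ s, ∑ m ∈ s, (conj (c n) * c m).re * (weilArchDensity t *
        (if n = m then 2 - 2 * (1 - t / (2 * a)) * Real.cos (π * n / a * t)
          else -(-1 : ℝ) ^ (n + m) * (Real.sin (π * m / a * t) - Real.sin (π * n / a * t)) / (π * (n - m)))))
      (Ioc 0 (2 * a)) := by
    intro t ht
    simp only
    rw [weilIncrement_sum_smul_chi ha s c ht.1.le ht.2, Finset.mul_sum]
    refine Finset.sum_congr rfl fun n _ ↦ ?_
    rw [Finset.mul_sum]
    refine Finset.sum_congr rfl fun m _ ↦ ?_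
    ring
  have hIoi : EqOn (fun t ↦ weilArchDensity t * weilIncrement (∑ n ∈ s, c n • chi a n) t)
      (fun t ↦ ∑ n ∈ s, ∑ m ∈ s, (conj (c n) * c m).re * (weilArchDensity t * (if n = m then 2 else 0)))
      (Ioi (2 * a)) := by
    intro t ht
    simp only
    rw [weilIncrement_sum_smul_chi_of_le ha s c (le_of_lt ht), Finset.mul_sum]
    refine Finset.sum_congr rfl fun n _ ↦ ?_
    rw [Finset.mul_sum]
    refine Finset.sum_congr rfl fun m _ ↦ ?_
    ring
  -- integrability on the two ranges
  have iIoc : ∀ n m : ℤ, IntegrableOn (fun t ↦ (conj (c n) * c m).re * (weilArchDensity t *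
      (if n = m then 2 - 2 * (1 - t / (2 * a)) * Real.cos (π * n / a * t)
        else -(-1 : ℝ) ^ (n + m) * (Real.sin (π * m / a * t) - Real.sin (π * n / a * t)) / (π * (n - m)))))
      (Ioc 0 (2 * a)) := fun n m ↦ (integrableOn_weilArchDensity_mul_kernel ha n m).const_mul _
  have iIoi : ∀ n m : ℤ, IntegrableOn (fun t ↦ (conj (c n) * c m).re * (weilArchDensity t * (if n = m then 2 else 0)))
      (Ioi (2 * a)) := fun n m ↦ ((integrableOn_weilArchDensity_Ioi hT).mul_const _).const_mul _
  have iA : IntegrableOn (fun t ↦ weilArchDensity t * weilIncrement (∑ n ∈ s, c n • chi a n) t) (Ioc 0 (2 * a)) :=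
    IntegrableOn.congr_fun (integrable_finsetSum s fun n _ ↦ integrable_finsetSum s fun m _ ↦ iIoc n m)
      hIoc.symm measurableSet_Ioc
  have iB : IntegrableOn (fun t ↦ weilArchDensity t * weilIncrement (∑ n ∈ s, c n • chi a n) t) (Ioi (2 * a)) :=
    IntegrableOn.congr_fun (integrable_finsetSum s fun n _ ↦ integrable_finsetSum s fun m _ ↦ iIoi n m)
      hIoi.symm measurableSet_Ioi
  rw [← Ioc_union_Ioi_eq_Ioi hT.le, setIntegral_union Ioc_disjoint_Ioi_same measurableSet_Ioi iA iB,
    setIntegral_congr_fun measurableSet_Ioc hIoc, setIntegral_congr_fun measurableSet_Ioi hIoi,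
    integral_finsetSum _ (fun n _ ↦ integrable_finsetSum s fun m _ ↦ iIoc n m),
    integral_finsetSum _ (fun n _ ↦ integrable_finsetSum s fun m _ ↦ iIoi n m), ← Finset.sum_add_distrib]
  refine Finset.sum_congr rfl fun n _ ↦ ?_
  rw [integral_finsetSum _ (fun m _ ↦ iIoc n m), integral_finsetSum _ (fun m _ ↦ iIoi n m),
    ← Finset.sum_add_distrib]
  refine Finset.sum_congr rfl fun m _ ↦ ?_
  rw [MeasureTheory.integral_const_mul, MeasureTheory.integral_const_mul, ← mul_add]
  congr 1
  by_cases h : n = m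
  · subst h
    simp only [if_true]
  · simp only [if_neg h, mul_zero, MeasureTheory.integral_zero, add_zero]
    have hfun : (fun t : ℝ ↦ weilArchDensity t *
        (-(-1 : ℝ) ^ (n + m) * (Real.sin (π * m / a * t) - Real.sin (π * n / a * t)) / (π * (n - m)))) =
        fun t ↦ (-(-1 : ℝ) ^ (n + m) / (π * (n - m))) *
          (weilArchDensity t * Real.sin (π * m / a * t) - weilArchDensity t * Real.sin (π * n / a * t)) := by
      funext t; ring
    rw [hfun, MeasureTheory.integral_const_mul,
      integral_sub (integrableOn_weilArchDensity_mul_sin ha m) (integrableOn_weilArchDensity_mul_sin ha n)]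

end Summit.RiemannHypothesis.RiemannHypothesis.Theorems.WeilFormatC
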